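import Summits.QuantumFields.BalabanUV.Beta.SymBorderJetWard
import Summits.QuantumFields.BalabanUV.Beta.RootedT2JetAdditive

/-!
# `BalabanUV.Beta.SymRootedT2JetAdditive` — THE (0.4)-SYMMETRISED ROOTED BORDER JET `symT2At` IS ADDITIVE IN EACH BACKGROUND SLOT (scalar fluctuation `upF W`)
# (β sub-cell, row D1, TABLES-SYM-LEAN S2c∕S2d, INTERFACE-LEVEL twin of an2-g21's `RootedT2JetAdditive` (G3b); an1 gen 43; the border path to (T2-B))

HONEST FRAMING (cell charter, verbatim): «discharging BetaPertH makes Bałaban's UV stability UNCONDITIONAL — a real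
constructive-QFT result; it is NOT the continuum limit and NOT the Clay problem.»  HONEST DEPENDENCY (verbatim): «continuum YM on
T⁴ ⇐ BetaPertH ∧ nine spine estimates (0/9 proved); BetaPertH ⇐ (D1) ∧ (D4) ∧ CAP+tail; G-an2-4 gates asym, D1 and NE2/3/4.»
ABSOLUTE RULE (R-g25-7 ∕ R-D1-g30-1 (A)): the (0.4)-symmetrised averaging is the exp of the MEAN OF LOGS over the pair family
`{loop^{σ,σ′}}` with weight `((d!)²·L^d)⁻¹`; every object below is the comb module's algebra read on an1's `symPhiGAt` (S2b part 1)
instead of `PhiGAt` — STATEMENT FOR STATEMENT under the dictionary `PhiXAt ↦ symPhiXAt`, `XjetAt ↦ symXjetAt`, `MσXAt ↦ symMσXAt`,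
`L^{-d}·linAvgAt ↦ (d!·L^d)⁻¹·symLinU`, `L^{-d}·hessUAt ↦ ((d!)²L^d)⁻¹·symHessUAt`, `L^{-2d}·vhUAt ↦ ((d!)²L^{2d})⁻¹·symVhUAt`
(an3-g63 [AN3-G63-S2C] (C-ii): constants PER BCH ORDER; CONVENTION `(d!)²` un-normalised inside order-2 sym functionals).
FAMILY-INDEPENDENT chart ∕ letter ∕ `Tau`-algebra lemmas of the comb module are imported BY NAME, never re-proved.
DERIVED cell leaf: [folklore] ring algebra; the `sym*` families are [our object]s.  No statement of Bałaban's papers is typed here, no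
`[cite:]` tag, no `Prop` is minted, no binder of the β-function wall (`hW`/`hR`/`D1Tel`/`D1Rep`, (D1), `BetaPertH`) is instantiated or
discharged; nothing about the VALUES of `symMixFFAt`∕`symVh₂SAt` and no (T2-B)∕(T2-M₂) letter is discharged in this file.
NOT D1, NOT BetaPertH, NOT continuum, NOT Clay.  NOT summit progress.
Provenance: β sub-cell, TABLES-SYM-LEAN S2c option (C) (S2C-SCOPE-v1 94facb80ac685517), unit b2b-balaban-beta-an1-g43 (W-supplier AN1,
FREEZE (0): scratch for a courier; an1 files nothing), 2026-08-21; no existing file touched.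

## What this module proves (sym twin of `RootedT2JetAdditive` §3–§4; its §1 slot∕kill maps `Ψ₁ Ψ₂ K₁ K₂` and §2 `ε`-lifted letters `Wl E1 Eb1 S1 Sb1 E2 Eb2 S2 Sb2`
## with their images are letter algebra, the comb module's BY NAME)
* §3 `c11_symQjetAt_add_B_aux`, `c11_symQjetAt_add_B'_aux` (slot additivity with the `ε`-remainder, by an1's `SymRootedJetTwist.map_symQjetLAt` under `Ψ₁`∕`Ψ₂`∕`killHom`∕`K₁`∕`K₂`),
  `c11_symQjetAt_add_B`, `c11_symQjetAt_add_B'` (char ≠ 2; the remainder dies by an1's `SymBorderJetWard.c11_symQjetAt_upF_zero_B/_B'`).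
* §4 **`symT2At_add_B`, `symT2At_add_B'`, `symT2At_zero_B`, `symT2At_sub_B`, `symT2At_sum_B`** — `symT2At ρ (upF W)` is additive in each background
  (the second slot by `symT2At_symm`, S2b part 1).  No constants enter: this file carries no `(d ! : 𝕜) ≠ 0` hypothesis.
-/

namespace Summit.QuantumFields.BalabanUV.Beta.SymRootedT2JetAdditive

open Finset
open Literature.MathematicalPhysics.QuantumFieldTheory.Balaban1983to89
open Literature.MathematicalPhysics.QuantumFieldTheory.Balaban1983to89.Beta
open AffineAveraging (Form1)
open AveragingThirdJet (Tau Rho dmk fst_dmk snd_dmk dfst_mul dsnd_mul mapDual upF upF_apply Ebg Ebi)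
open AveragingThirdJet.Tau (τ₁ τ₂ τ12 ι c00 c10 c01 c11 mk ext4)
open Summit.QuantumFields.BalabanUV.Beta.SymAveragingMixedJetTables (symQjetAt symT2At symT2At_symm)
open Summit.QuantumFields.BalabanUV.Beta.SymRootedJetReflection (symQjetLAt symQjetAt_eq_symQjetLAt)
open Summit.QuantumFields.BalabanUV.Beta.RootedJetTwist (killHom lineHom liftT c00_killHom c10_killHom c01_killHom c11_killHom
  c00_lineHom c10_lineHom c01_lineHom c11_lineHom)
open Summit.QuantumFields.BalabanUV.Beta.SymRootedJetTwist (map_symQjetLAt)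
open Summit.QuantumFields.BalabanUV.Beta.RootedT2JetDictionary (pr1 pr2 fst_pr1 snd_pr1 fst_pr2 snd_pr2)
open Summit.QuantumFields.BalabanUV.Beta.SymRootedT2JetDictionary (symT2At_upF_neg_B)
open Summit.QuantumFields.BalabanUV.Beta.SymBorderJetWard (c11_symQjetAt_upF_zero_B c11_symQjetAt_upF_zero_B')
open Summit.QuantumFields.BalabanUV.Beta.RootedT2JetAdditive (Ψ₁ Ψ₂ c11_Ψ₁ c11_Ψ₂ c00_Ψ₁ c10_Ψ₁ c01_Ψ₁ c00_Ψ₂ c10_Ψ₂ c01_Ψ₂ K₁ K₂ c00_K₁ c10_K₁ c01_K₁ c11_K₁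
  c00_K₂ c10_K₂ c01_K₂ c11_K₂ Wl E1 Eb1 S1 Sb1 E2 Eb2 S2 Sb2 Ψ₁_upF Ψ₂_upF kill_upF K₁_upF K₂_upF Ψ₁_E1 Ψ₁_Eb1 kill_E1 kill_Eb1 K₁_E1 K₁_Eb1 Ψ₂_E2 Ψ₂_Eb2
  kill_E2 kill_Eb2 K₂_E2 K₂_Eb2)

variable {𝕜 : Type*} [Field 𝕜] {d : ℕ} {𝔸 : Type*} [Ring 𝔸] [Algebra 𝕜 𝔸]

/-! ## §1–§2 The slot maps `Ψ₁ Ψ₂`, the partial kill maps `K₁ K₂`, the `ε`-lifted letters and their images: letter algebra, the comb module's BY NAME -/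

/-! ## §3 Additivity of `c11 symQ^ρ(upF W; ·, ·)` in each background slot -/

section Additivity

variable (ρ : Fin d → ℤ) (W : Form1 d 𝔸) (L : ℕ) (μ : Fin d) (y : Fin d → ℤ)

/-- [folklore] **SLOT 1, WITH REMAINDER**: `c11 symQ(B₁ + B₂, B′) = c11 symQ(B₁, B′) + ε-part(c10 symQ♭)`, `symQ♭` the jet of the `B₁`-FREE shadow letters. -/
theorem c11_symQjetAt_add_B_aux (B₁ B₂ B' : Form1 d 𝔸) :
    c11 (symQjetAt 𝕜 ρ (upF W) (B₁ + B₂) B' L μ y)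
      = c11 (symQjetAt 𝕜 ρ (upF W) B₁ B' L μ y) + (c10 (symQjetLAt 𝕜 ρ (upF (Wl W)) (S1 B₂ B') (Sb1 B₂ B') L μ y)).snd := by
  have h1 := map_symQjetLAt (R := DualNumber 𝔸) (R' := 𝔸) (Ψ₁ (𝕜 := 𝕜)) ρ (upF (Wl W)) (E1 B₁ B₂ B') (Eb1 B₁ B₂ B') L μ y
  have h2 := map_symQjetLAt (R := DualNumber 𝔸) (R' := 𝔸) (killHom (𝕜 := 𝕜)) ρ (upF (Wl W)) (E1 B₁ B₂ B') (Eb1 B₁ B₂ B') L μ y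
  have h3 := map_symQjetLAt (R := DualNumber 𝔸) (R' := DualNumber 𝔸) (K₁ (𝕜 := 𝕜)) ρ (upF (Wl W)) (E1 B₁ B₂ B') (Eb1 B₁ B₂ B') L μ y
  rw [Ψ₁_upF, Ψ₁_E1, Ψ₁_Eb1, ← symQjetAt_eq_symQjetLAt] at h1
  rw [kill_upF, kill_E1, kill_Eb1, ← symQjetAt_eq_symQjetLAt] at h2
  rw [K₁_upF, K₁_E1, K₁_Eb1] at h3
  rw [← h1, ← h2, ← h3, c11_Ψ₁, c11_killHom, c10_K₁]

/-- [folklore] **SLOT 2, WITH REMAINDER**. -/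
theorem c11_symQjetAt_add_B'_aux (B B'₁ B'₂ : Form1 d 𝔸) :
    c11 (symQjetAt 𝕜 ρ (upF W) B (B'₁ + B'₂) L μ y)
      = c11 (symQjetAt 𝕜 ρ (upF W) B B'₁ L μ y) + (c10 (symQjetLAt 𝕜 ρ (upF (Wl W)) (S2 B B'₂) (Sb2 B B'₂) L μ y)).snd := by
  have h1 := map_symQjetLAt (R := DualNumber 𝔸) (R' := 𝔸) (Ψ₂ (𝕜 := 𝕜)) ρ (upF (Wl W)) (E2 B B'₁ B'₂) (Eb2 B B'₁ B'₂) L μ y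
  have h2 := map_symQjetLAt (R := DualNumber 𝔸) (R' := 𝔸) (killHom (𝕜 := 𝕜)) ρ (upF (Wl W)) (E2 B B'₁ B'₂) (Eb2 B B'₁ B'₂) L μ y
  have h3 := map_symQjetLAt (R := DualNumber 𝔸) (R' := DualNumber 𝔸) (K₂ (𝕜 := 𝕜)) ρ (upF (Wl W)) (E2 B B'₁ B'₂) (Eb2 B B'₁ B'₂) L μ y
  rw [Ψ₂_upF, Ψ₂_E2, Ψ₂_Eb2, ← symQjetAt_eq_symQjetLAt] at h1
  rw [kill_upF, kill_E2, kill_Eb2, ← symQjetAt_eq_symQjetLAt] at h2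
  rw [K₂_upF, K₂_E2, K₂_Eb2] at h3
  rw [← h1, ← h2, ← h3, c11_Ψ₂, c11_killHom, c10_K₂]

variable (h2 : (2 : 𝕜) ≠ 0)
include h2

/-- [folklore] **ADDITIVITY OF `c11 symQ^ρ(upF W; ·, B′)` IN THE `τ₁`-BACKGROUND** (char ≠ 2). -/
theorem c11_symQjetAt_add_B (B₁ B₂ B' : Form1 d 𝔸) :
    c11 (symQjetAt 𝕜 ρ (upF W) (B₁ + B₂) B' L μ y) = c11 (symQjetAt 𝕜 ρ (upF W) B₁ B' L μ y) + c11 (symQjetAt 𝕜 ρ (upF W) B₂ B' L μ y) := by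
  have e := c11_symQjetAt_add_B_aux (𝕜 := 𝕜) ρ W L μ y 0 B₂ B'
  rw [zero_add, c11_symQjetAt_upF_zero_B h2, zero_add] at e
  rw [c11_symQjetAt_add_B_aux, e]

/-- [folklore] **ADDITIVITY OF `c11 symQ^ρ(upF W; B, ·)` IN THE `τ₂`-BACKGROUND** (char ≠ 2). -/
theorem c11_symQjetAt_add_B' (B B'₁ B'₂ : Form1 d 𝔸) :
    c11 (symQjetAt 𝕜 ρ (upF W) B (B'₁ + B'₂) L μ y) = c11 (symQjetAt 𝕜 ρ (upF W) B B'₁ L μ y) + c11 (symQjetAt 𝕜 ρ (upF W) B B'₂ L μ y) := by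
  have e := c11_symQjetAt_add_B'_aux (𝕜 := 𝕜) ρ W L μ y B 0 B'₂
  rw [zero_add, c11_symQjetAt_upF_zero_B' h2, zero_add] at e
  rw [c11_symQjetAt_add_B'_aux, e]

/-! ## §4 Additivity of `symT2At ρ (upF W)` in the first background (the second by `symT2At_symm`) -/

/-- [folklore] **`symT2At ρ (upF W)` IS ADDITIVE IN ITS FIRST BACKGROUND.** -/
theorem symT2At_add_B (B₁ B₂ B' : Form1 d 𝔸) :
    symT2At 𝕜 ρ (upF W) (B₁ + B₂) B' L μ y = symT2At 𝕜 ρ (upF W) B₁ B' L μ y + symT2At 𝕜 ρ (upF W) B₂ B' L μ y := by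
  simp only [symT2At, c11_symQjetAt_add_B ρ W L μ y h2, c11_symQjetAt_add_B' ρ W L μ y h2]
  abel

/-- [folklore] … and in its second background. -/
theorem symT2At_add_B' (B B'₁ B'₂ : Form1 d 𝔸) :
    symT2At 𝕜 ρ (upF W) B (B'₁ + B'₂) L μ y = symT2At 𝕜 ρ (upF W) B B'₁ L μ y + symT2At 𝕜 ρ (upF W) B B'₂ L μ y := by
  rw [symT2At_symm (𝕜 := 𝕜) ρ (upF W) (B'₁ + B'₂) B L μ y, symT2At_add_B ρ W L μ y h2, ← symT2At_symm (𝕜 := 𝕜) ρ (upF W) B'₁ B L μ y,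
    ← symT2At_symm (𝕜 := 𝕜) ρ (upF W) B'₂ B L μ y]

/-- [folklore] `symT2At ρ (upF W) 0 B′ = 0`. -/
theorem symT2At_zero_B (B' : Form1 d 𝔸) : symT2At 𝕜 ρ (upF W) 0 B' L μ y = 0 := by
  rw [symT2At, c11_symQjetAt_upF_zero_B h2, c11_symQjetAt_upF_zero_B' h2, add_zero]

/-- [folklore] `symT2At ρ (upF W)` is subtractive in its first background. -/
theorem symT2At_sub_B (B₁ B₂ B' : Form1 d 𝔸) :
    symT2At 𝕜 ρ (upF W) (B₁ - B₂) B' L μ y = symT2At 𝕜 ρ (upF W) B₁ B' L μ y - symT2At 𝕜 ρ (upF W) B₂ B' L μ y := by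
  rw [sub_eq_add_neg, symT2At_add_B ρ W L μ y h2, symT2At_upF_neg_B, ← sub_eq_add_neg]

/-- [folklore] `symT2At ρ (upF W)` of a finite sum of first backgrounds. -/
theorem symT2At_sum_B {ι' : Type*} (s : Finset ι') (B : ι' → Form1 d 𝔸) (B' : Form1 d 𝔸) :
    symT2At 𝕜 ρ (upF W) (∑ i ∈ s, B i) B' L μ y = ∑ i ∈ s, symT2At 𝕜 ρ (upF W) (B i) B' L μ y := by
  classical
  induction s using Finset.induction_on with
  | empty => rw [Finset.sum_empty, Finset.sum_empty, symT2At_zero_B ρ W L μ y h2]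
  | insert i s hi ih => rw [Finset.sum_insert hi, Finset.sum_insert hi, symT2At_add_B ρ W L μ y h2, ih]

end Additivity

end Summit.QuantumFields.BalabanUV.Beta.SymRootedT2JetAdditive
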